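import Mathlib
import HarnessLib

/-!
# Venture HSemireg — the tangency reduction of the cubic supertrace law (W³): str T = 0 from the antisymmetrised tangency law (TAN×)

HONEST FRAMING. Lean leaf for the computation cell `pub-hsemireg` (target seat t-5 gen 17; file of record
`run/shared/lean/pub/pub-hsemireg/target-g6/W3-LAWS-t5g17.md` §3.6, building on th-3 gen 28's
`theory/TH3-SIGMA-ORBIT-PROOF.md` §5.1 and its leaf `FibreTestSigmaOrbitStep`). In the minimal twisted-complex
model of a «reduced-point complex» on a smooth threefold germ a W-class has even components `B₁, B₂, B₃` and odd
potentials `V₁, V₂, V₃` tied to the three odd gluing operators `u₁, u₂, u₃` by the Killing relation (E1)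
`{u_l, V_j} = ε_{jli} B_i`; in particular `{u_{i+1}, V″_{i+1}} = 0` (conormality) and
`B″_i = {u_{i-1}, V″_{i+1}}`. For three classes the cubic form is `T = Σ_i C_i B″_i` with the cross products
`C_i = (B × B′)_i`, and Conjecture (W³) says `str T = 0`. THIS FILE kernel-checks the REDUCTION of t-5 g17 §3.6 in
its invariant form on the total space `U` with parity operator `σ` (`str X = trace (σ X)`), all operators taken in
the endomorphism ring `Module.End F U`: if each commutator `C_i u_{i-1} - u_{i-1} C_i` is tangent to the conjugation
orbit of `u_{i+1}`, i.e. equals `ξ_i u_{i+1} - u_{i+1} ξ_i` for some `ξ_i` (this is the law (TAN×) at a generic frame,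
OBSERVED on every instance but NOT proved), then `trace (σ Σ_i C_i (u_{i-1} y_i + y_i u_{i-1})) = 0` whenever
`u_{i+1} y_i + y_i u_{i+1} = 0`. The two algebraic steps are the adjointness identity
`trace (σ C (a y + y a)) = trace (σ (C a - a C) y)` (C even, a odd) and th-3's orbit step
`trace (σ (ξ x - x ξ) y) = 0` for `x y + y x = 0` (kernel-checked in `FibreTestSigmaOrbitStep` for `∘ₗ`; re-derived
inline below in ring form). (TAN×) itself, the orbit lemma, the model and everything about HC are NOT formalised;
nothing here says (W³) is proved; no object is constructed; nothing here bears on HC, HC_CM or HC_AV.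
-/

namespace Summit.Ventures.HSemireg

open LinearMap

variable {F : Type*} [Field F]
variable {U : Type*} [AddCommGroup U] [Module F U]

/-- **Adjointness of `δ_a` and `ad_a` under the supertrace** (endomorphism-ring form). For a parity operator `σ`
commuting with the even operator `C` and anticommuting with the odd operator `a` (`σ a = -(a σ)`), and any `y`:
`trace (σ C (a y + y a)) = trace (σ (C a - a C) y)` — i.e. `str(C·{a,y}) = str([C,a]·y)`
(TH3-SIGMA-ORBIT-PROOF §3.4 P4; W3-LAWS-t5g17 §3.6). Proof: `trace (σ C y a) = trace (a σ C y) = -trace (σ a C y)` by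
cyclicity of the trace and the anticommutation. (The hypothesis `σ C = C σ` is not even needed for this identity; it
is kept in the statement of the reduction below, where it is part of the meaning of «`C` even».) [folklore] -/
theorem supertrace_mul_anticomm_eq_supertrace_comm_mul (σ C a y : Module.End F U)
    (hσa : σ * a = -(a * σ)) :
    LinearMap.trace F U (σ * C * (a * y + y * a)) = LinearMap.trace F U (σ * (C * a - a * C) * y) := by
  have haσ : a * σ = -(σ * a) := by rw [hσa, neg_neg]
  -- operator identity: a (σ C y) = -(σ a C y)
  have op : a * (σ * C * y) = -(σ * a * C * y) := by
    calc a * (σ * C * y) = (a * σ) * (C * y) := by noncomm_ring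
      _ = (-(σ * a)) * (C * y) := by rw [haσ]
      _ = -(σ * a * C * y) := by noncomm_ring
  have key : LinearMap.trace F U (σ * C * y * a) = -LinearMap.trace F U (σ * a * C * y) := by
    rw [LinearMap.trace_mul_comm, op, map_neg]
  have expandL : σ * C * (a * y + y * a) = σ * C * a * y + σ * C * y * a := by noncomm_ring
  have expandR : σ * (C * a - a * C) * y = σ * C * a * y - σ * a * C * y := by noncomm_ring
  rw [expandL, expandR, map_add, map_sub, key, sub_eq_add_neg]

/-- **Orbit step, endomorphism-ring form** (th-3 g28, `FibreTestSigmaOrbitStep.trace_parity_orbitTangent_comp_eq_zero`,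
restated for `Module.End` with `*`): if `σ x = -(x σ)` and `x y + y x = 0` then `trace (σ (ξ x - x ξ) y) = 0` for every
`ξ` — a vector tangent to the conjugation orbit of `x` pairs to zero with a covector conormal at `x`. Proof:
`trace (σ x ξ y) = trace (ξ y σ x) = -trace (ξ y x σ) = trace (ξ x y σ) = trace (σ ξ x y)`. [folklore] -/
theorem supertrace_orbitTangent_mul_eq_zero (σ x y ξ : Module.End F U)
    (hσx : σ * x = -(x * σ)) (hxy : x * y + y * x = 0) :
    LinearMap.trace F U (σ * (ξ * x - x * ξ) * y) = 0 := by
  have hyx : y * x = -(x * y) := eq_neg_of_add_eq_zero_right hxy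
  -- operator identity: (ξ y) (σ x) = (ξ (x y)) σ, using σ x = -(x σ) and y x = -(x y)
  have op : (ξ * y) * (σ * x) = (ξ * (x * y)) * σ := by
    calc (ξ * y) * (σ * x) = ξ * y * (σ * x) := by noncomm_ring
      _ = ξ * y * (-(x * σ)) := by rw [hσx]
      _ = -(ξ * (y * x) * σ) := by noncomm_ring
      _ = -(ξ * (-(x * y)) * σ) := by rw [hyx]
      _ = (ξ * (x * y)) * σ := by noncomm_ring
  have assoc1 : σ * x * ξ * y = (σ * x) * (ξ * y) := by noncomm_ring
  have assoc2 : σ * (ξ * (x * y)) = σ * ξ * x * y := by noncomm_ring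
  have key : LinearMap.trace F U (σ * x * ξ * y) = LinearMap.trace F U (σ * ξ * x * y) := by
    rw [assoc1, LinearMap.trace_mul_comm, op, LinearMap.trace_mul_comm, assoc2]
  have expand : σ * (ξ * x - x * ξ) * y = σ * ξ * x * y - σ * x * ξ * y := by noncomm_ring
  rw [expand, map_sub, key, sub_self]

/-- **One term of the tangency reduction.** With `σ` the parity operator (anticommuting with the odd `a` and `x`),
`x y + y x = 0` (conormality of `y` at `x`, = the Killing relation `{u_{i+1}, V″_{i+1}} = 0`), and the TANGENCY
hypothesis `C a - a C = ξ x - x ξ` (the commutator `[C,a]` is tangent to the conjugation orbit of `x`; for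
`C = (B×B′)_i`, `a = u_{i-1}`, `x = u_{i+1}` this is the law (TAN×) of W3-LAWS-t5g17 at a generic frame), the term
`str(C·{a,y}) = trace (σ C (a y + y a))` vanishes: by the adjointness lemma it equals `trace (σ (ξ x - x ξ) y)`,
which is the orbit step. [folklore] -/
theorem supertrace_mul_anticomm_eq_zero_of_tangent (σ C a x y ξ : Module.End F U)
    (hσa : σ * a = -(a * σ)) (hσx : σ * x = -(x * σ))
    (hxy : x * y + y * x = 0) (htan : C * a - a * C = ξ * x - x * ξ) :
    LinearMap.trace F U (σ * C * (a * y + y * a)) = 0 := by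
  rw [supertrace_mul_anticomm_eq_supertrace_comm_mul σ C a y hσa, htan]
  exact supertrace_orbitTangent_mul_eq_zero σ x y ξ hσx hxy

/-- **The tangency reduction of (W³) (three-term form).** Data in the endomorphism ring of the total space `U` of a
four-level (or any) reduced-point complex: the parity operator `σ`; the three odd gluing operators `u₁ u₂ u₃`
(`σ` anticommutes with each); the three cross products `C₁ C₂ C₃` of two W-classes (even; no hypothesis on them is
needed beyond tangency); the three odd potentials `y₁ y₂ y₃` of a third class in the slots where they are CONORMAL:
`u₂ y₁ + y₁ u₂ = 0`, `u₃ y₂ + y₂ u₃ = 0`, `u₁ y₃ + y₃ u₁ = 0` (the Killing relations `{u_{i+1},V″_{i+1}} = 0` with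
`y_i := V″_{i+1}`), so that by (E1) the third class has `B″_i = {u_{i-1}, y_i}` and the cubic form is
`T = Σ_i C_i (u_{i-1} y_i + y_i u_{i-1})` (`T = Σ_i (B×B′)_i B″_i`, W3-PATHALG-t5g13 §1). HYPOTHESIS (TAN×) at this
frame: each `[C_i, u_{i-1}]` is tangent to the conjugation orbit of `u_{i+1}`. CONCLUSION: `str T = trace (σ T) = 0`.
This is exactly the conditional reduction «(TAN×) ⇒ (W³)» of W3-LAWS-t5g17 §3.6 / TH3-SIGMA-ORBIT-PROOF §5.1;
(TAN×) is observed on every instance on record and is NOT proved; (W³) for four or more levels remains OPEN. [folklore] -/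
theorem supertrace_cubicForm_eq_zero_of_crossTangency (σ u₁ u₂ u₃ C₁ C₂ C₃ y₁ y₂ y₃ ξ₁ ξ₂ ξ₃ : Module.End F U)
    (hσu₁ : σ * u₁ = -(u₁ * σ)) (hσu₂ : σ * u₂ = -(u₂ * σ)) (hσu₃ : σ * u₃ = -(u₃ * σ))
    (hy₁ : u₂ * y₁ + y₁ * u₂ = 0) (hy₂ : u₃ * y₂ + y₂ * u₃ = 0) (hy₃ : u₁ * y₃ + y₃ * u₁ = 0)
    (htan₁ : C₁ * u₃ - u₃ * C₁ = ξ₁ * u₂ - u₂ * ξ₁)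
    (htan₂ : C₂ * u₁ - u₁ * C₂ = ξ₂ * u₃ - u₃ * ξ₂)
    (htan₃ : C₃ * u₂ - u₂ * C₃ = ξ₃ * u₁ - u₁ * ξ₃) :
    LinearMap.trace F U (σ * (C₁ * (u₃ * y₁ + y₁ * u₃) + C₂ * (u₁ * y₂ + y₂ * u₁)
      + C₃ * (u₂ * y₃ + y₃ * u₂))) = 0 := by
  have h1 := supertrace_mul_anticomm_eq_zero_of_tangent σ C₁ u₃ u₂ y₁ ξ₁ hσu₃ hσu₂ hy₁ htan₁
  have h2 := supertrace_mul_anticomm_eq_zero_of_tangent σ C₂ u₁ u₃ y₂ ξ₂ hσu₁ hσu₃ hy₂ htan₂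
  have h3 := supertrace_mul_anticomm_eq_zero_of_tangent σ C₃ u₂ u₁ y₃ ξ₃ hσu₂ hσu₁ hy₃ htan₃
  have expand : σ * (C₁ * (u₃ * y₁ + y₁ * u₃) + C₂ * (u₁ * y₂ + y₂ * u₁) + C₃ * (u₂ * y₃ + y₃ * u₂))
      = σ * C₁ * (u₃ * y₁ + y₁ * u₃) + σ * C₂ * (u₁ * y₂ + y₂ * u₁) + σ * C₃ * (u₂ * y₃ + y₃ * u₂) := by
    noncomm_ring
  rw [expand, map_add, map_add, h1, h2, h3, add_zero, add_zero]

end Summit.Ventures.HSemireg
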